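import Literature.MathematicalPhysics.QuantumFieldTheory.Balaban1983to89.Node00.N24NodesStage13PinX3HSSepCoPH
import Literature.MathematicalPhysics.QuantumFieldTheory.Balaban1983to89.Node00.Record13CarriersB8SubBP2C

/-!
# NODE N24 · THE `b8`-GENERIC FOUR-PIN ENGINE: (B2), (B) AND K1⁷'s θ-KEYED CONSEQUENT AT A WORLD BOUND TO THE FOUR-PIN VIEW OF `θ.rebindX X′` WITH THE [B8] BLOCK RE-BOUND TO AN
# ARBITRARY RUN-INDEXED PROPOSITION `b8sel P` (`Upstream.withB8`) — the X′-generic S-bound engine of `Node00/N24NodesStage13PinX3HSSepCoPH` §0–§2 with the RS binding `upOfRecord₅CS`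
# (= `withB8 (B8LeafRS …)`) generalised to ANY `b8` currency; instances: the RS engine itself (not restated) and ★ the REPAIRED-CURRENCY «P₂C» SC-BINDING `upOfRecord₅CSC … C₇`
# (dag-n05-w1, `withB8 (B8LeafRSC … C₇ …)`) — the binding under which N05's lanes deliver after dag-n05-d's DESIGN «P₂C»

TRACK A (YM-PLAN §2d, node N24 of 28 = binder B2 `hB : B16.EndStatementBPrinted D.C`), seat `pub-ymgap-dag-n24-c` (R134 fan-out seat, strategy s2; gen 10).  A NEW importing module
(imports this seat's S-bound engine `N24NodesStage13PinX3HSSepCoPH` — whence the C-bound twin record `N24_isRecordOfRecord₁₃CCoPH_twin_of_upS_rebindX_view`, the transfers, dag-n10-d's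
four-pin leaves, node00-def's `leavesP_eq_of_up_withB8` — and dag-n05-w1's `Record13CarriersB8SubBP2C` (p605652-class: `upOfRecord₅CSC θ C₇ P := (upOfRecord₅C θ P).withB8 (B8LeafRSC … C₇ …)`,
the repaired-currency binding) for the SC instances).  APPEND-ONLY: nothing below is edited; the RS engine STANDS.  THEOREMS ONLY, def-free, sorry-free, standard axioms.

WHY (dag-n05-d g11 DESIGN «P₂C» 2026-08-28T03:12Z; dag-n05-w1 `CarriersB8SubBP2C` ∕ `Record13CarriersB8SubBP2C`; dag-n05-w2's necessity certificate p605631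
`not_prop7PrintedR_zdGF3HP₂_toAxialTower_halfspace`; dag-n05-w4's `b8`-generic class `Record13SClassSepCoPHG` p607735 and OFFER l.29711 «the engine's SC twin … say if wanted» — taken
here by the engine's author in the GENERIC form).  The N05 slot every printed member of [Balaban1985RegularSpaces] serves is `B8LeafOfRecordSubBP₂C θ₃ λ₈` — `B8LeafRSC` at
`C₇ = 530·D·L²` (Proposition 7 in the REPAIRED currency with print's tower-wise axial map PINNED; print's `2α₂` with that map is certified false on the δ₂ carrier) — and it is bound at
records by `upOfRecord₅CSC`, not by `upOfRecord₅CS` (whose `b8` is the RS leaf).  The S engine's PROOF never read the `b8` currency: N05's node is `B8LeafKnit.b8_main_of_leaf` at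
whatever `b8` the world carries, N01–N04 ∕ the guarded (0.20) ∕ the β-window come from the C-BOUND TWIN WORLD `{ w with up := upOfRecord₅C (…) }` (none reads `b8`), N06–N13 read
their own leaves (`withB8` keeps them, `rfl`).  So the engine generalises VERBATIM to `w.up P = (upOfRecord₅C (view) P).withB8 (b8sel P)` with N05 ← `h05G : ∀ P, b8sel P`: ONE
engine for the RS binding (`b8sel P := B8LeafRS …`, `upOfRecord₅CS_eq_withB8`), the SC binding (`b8sel P := (upOfRecord₅CSC … C₇ P).b8`, `rfl` on dag-n05-w1's definition — §3),
dag-n05-w4's G-class worlds (`IsRecordOfRecord₁₃CSepCoPHG`: `…G_of_up_withB8_rebindX_view₁₃CoPHB10YZW` presents exactly these worlds), and any later currency of the [B8] slot.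
K1⁷'s TEXT (stmt-QuantumFields-20542: guard ∧ admissible ∧ (B) ∧ window at SOME `(θ', h')`) reads NO world and NO record class, so it is reachable on every binding (§2); the
REGISTERED v6 rung text `RecordS` pins the RS binding — whether a v7 re-types it over the G-class is the planners' word, not needed by the closers.

WHAT THIS FILE PROVES (7 theorems).
§0 `N24_rOperation_iff_of_up_withB8_rebindX_view_coPH` (the 𝐑-leaf reading at a `withB8`-bound four-pin view of `θ.rebindX X′`; `withB8` keeps `rOperation`).
§1 ★ **`N24_nodes₁₃CoPH_rebindX_withB8_fourPin_pointed`** (Core-keyed; `X′` AND `b8sel` FREE): the thirteen nodes at a world bound to `(upOfRecord₅C ((θ.rebindX X′).view₁₃CoPHB10YZW …) P).withB8 (b8sel P)`,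
   **N05 ← `h05G : ∀ P, b8sel P`**, N06 `B9LeafX (Y9OfRecord …)`, N07 `B11Leaf (Z11OfRecord ζ)`, N08 `PrintedUV3V N θ.L`, N09 Lemma 4 at `X′ P` + Thm-3 member, N10 the B13 socket at `X′ P`, N11 (S1ᵀ),
   N12 `B15Leaf (WOfRecord₁₃ θ λW P)`, N13 (R₁₃) + (UV₁₃) — proof = the S engine's bytes with `hw8 := hup` (`rfl` in place of `upOfRecord₅CS_eq_withB8`).
§2 **`N24_endStatementBPrinted₁₃CoPH_rebindX_withB8_fourPin_pointed`** ((B) at `(datumOfRecord₁₃CoPH θ hP).C` + β-pair) and the ITEM-FACING **`N24_stabilityBR13SepCoPH_thetaShape20_rebindX_withB8_fourPin_pointed`**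
   (K1⁷'s θ-keyed consequent witnessed by `(θ, hP)`, guard displayed).
§3 THE SC INSTANCES (`hup : w.up P = upOfRecord₅CSC F N (view) C₇ P`, N05 ← `h05SC : ∀ P, (upOfRecord₅CSC … C₇ P).b8` — at dag-n05-w4's X-P₂C pin `θ.pinX3P₂C λ₈ λ₁₂ λ₁₃` with
   `C₇ := c₇OfRecord θ₃` this `b8` IS `B8LeafOfRecordSubBP₂C θ₃ λ₈`, their `socket05SC_view₁₃CoPHB10YZW_pinX3P₂C_iff`, `Iff.rfl`): `N24_nodes₁₃CoPH_rebindXSC_fourPin_pointed`,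
   `N24_endStatementBPrinted₁₃CoPH_rebindXSC_fourPin_pointed`, `N24_stabilityBR13SepCoPH_thetaShape20_rebindXSC_fourPin_pointed` — one-line applications of §1∕§2 (`rfl` on `upOfRecord₅CSC`).

WHICH CHILD BLOCKS K1⁷ ON N05's «P₂C» ROUTE (kernel = §2's hypothesis list at `b8sel P := B8LeafOfRecordSubBP₂C θ₃ λ₈`): K0⁷'s `hP` + guard · world bound to the four-pin view with the
re-bound `b8` (free letters) · **N05 `B8LeafOfRecordSubBP₂C θ₃ λ₈`** (dag-n05-d p609803 `exists_residB8_b8LeafOfRecordSubBP₂C_of_lettersSrc_γ'` concludes `∃ λ₈` modulo its displayed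
[B9]-type sockets ∕ Prop-5 letters ∕ `5 ≤ L` ∕ `2 ≤ D`; ref-A READ-9 PASS, WATCH-P5-CARRIER-CHOICE) · N06 ∕ N07 ∕ N12 leaves at chosen layers · N08 PRINTED · N09 Lemma 4 at `X′ P` + Thm-3
member · N10 the B13 socket · N11 (S1ᵀ) · N13 (R₁₃) + (UV₁₃) · β-box pair ([I] (1.22); lower half UNPRINTED, NODE O).
HONEST FRAMING: kernel bookkeeping BY NAME; NO estimate; nothing of Bałaban's asserted; every slot DISPLAYED; Proposition 7 in the repaired currency is WEAKER than print's `2α₂`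
(declared by dag-n05-w1's pin, ref-A WATCH-P7-CURRENCY-RECORD); N05 NOT discharged; N24 COMPOSITE — no discharge, no count moved (5∕27 · A 5∕28), no stub closed; K0⁷ ∕ K1⁷ OPEN; one
finite T⁴ programme at fixed ε; R4 = the conditional finite-𝕋⁴ rung `BalabanLadder.UV` only — NOT continuum ∕ ℝ⁴ ∕ OS ∕ mass gap ∕ Clay.
-/

noncomputable section

open scoped Matrix.Norms.L2Operator

namespace Literature.MathematicalPhysics.QuantumFieldTheory.Balaban1983to89.Node00

open DagBinding T4Continuum T4DatumAssembly FlowStepRuns AveragingRT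
open FlowStep (BetaLowerH BetaUpperH)
open B14NodeKnitRecord9 (b14_main_at_construction_rhoOfRecord9_along)
open B16NodeKnitRepTowerOfRecord (b16_main_at_repTowerOfRecord_along)

variable {F : T4Family} {N : ℕ} [NeZero N]

/-! ## §0. The 𝐑-leaf reading at a `withB8`-bound four-pin view of a re-bound parameter -/

/-- **The pins and a `withB8` re-binding never touch the 𝐑-carrier**: at a world bound to `(upOfRecord₅C (four-pin view of θ.rebindX X′) P).withB8 b`,
`(leavesP w P).rOperation ↔ ∀ k < K, TLaw₁₃CoPH θ P k → SLaw₁₃CoPH θ P (k+1)` (`withB8` keeps `rOperation`, `Iff.rfl` to `ROpLeaf (VOfRecord₁₃CoPH (θ.rebindX X′) P)`, node00-def-T's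
`rOpLeaf_VOfRecord₁₃CoPH_iff`; the laws at the re-bound parameter ARE `θ`'s, `rfl`). [cite: Balaban1989LargeFieldII, Thm 1 p.355; Balaban1988Convergent, p.244 and Thm 2 p.263 (bookkeeping: the leaf unfolded)] -/
theorem N24_rOperation_iff_of_up_withB8_rebindX_view_coPH (θ : Stage13HParams F N) (X' : B12.RunParams → PrintedCarriersR) (Mstar : ℕ) (ops : OpsY N θ.toStage3Params Mstar)
    (ζ : ResidZ F N) (lamW : ResidW F N) {b : Prop} {w : WorldP} {P : B12.RunParams}
    (hup : w.up P = (upOfRecord₅C F N ((θ.rebindX F N X').view₁₃CoPHB10YZW F N Mstar ops ζ lamW) P).withB8 b) :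
    (leavesP w P).rOperation ↔ ∀ k, k < P.K → TLaw₁₃CoPH F N θ P k → SLaw₁₃CoPH F N θ P (k + 1) := by
  have hV : (leavesP w P).rOperation ↔ ROpLeaf (VOfRecord₁₃CoPH F N (θ.rebindX F N X') P) := by
    show (w.up P).rOperation ↔ _
    rw [hup]
    exact Iff.rfl
  exact hV.trans (rOpLeaf_VOfRecord₁₃CoPH_iff F N (θ.rebindX F N X') P)

/-! ## §1. The thirteen nodes at a world bound to the four-pin view of `θ.rebindX X'` with the `b8` block RE-BOUND to `b8sel` — N05 ← `b8sel P` itself -/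

/-- **★ N24 · THE THIRTEEN DAG NODES AT A WORLD BOUND TO THE FOUR-PIN VIEW OF `θ.rebindX X'` WITH THE [B8] BLOCK RE-BOUND TO `b8sel P`** (Core-keyed; the `b8`-GENERIC twin of
`N24_nodes₁₃CoPH_rebindXS_fourPin_pointed`, `X′` AND `b8sel` FREE): **N05 ← `h05G : ∀ P, b8sel P`** (the [B8] leaf in whatever currency the presenting lane reads — RS `B8LeafRS`, repaired
«P₂C» `B8LeafOfRecordSubBP₂C θ₃ λ₈` under dag-n05-w1's `upOfRecord₅CSC`, or the typed `B8LeafR`); N06 `B9LeafX (Y9OfRecord …)`; N07 `B11Leaf (Z11OfRecord F N ζ)`; N08 `PrintedUV3V N θ.L`;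
N09 own leaf at `X' P` + Theorem-3 member `h09T`; N10 B13 socket at `X' P`; N11 (S1ᵀ) `h11`; N12 `B15Leaf (WOfRecord₁₃ θ λW P)`; N13 (R₁₃) `hR` + (UV₁₃) `hUV`; N01 ∕ N02 ∕ N04
node00-def-T's transferred theorems and N03 at the C-bound twin, N10 at the twin — transported by `rfl` (`leavesP_eq_of_up_withB8`).  Proof = the S engine's bytes, `hw8 := hup`.
[cite: Balaban1989LargeFieldII, Thm 1 p.355, (0.1) pp.355–356, p.387, p.391; Balaban1985RegularSpaces, Lemma 1 – Thm 8 pp.79–101, Prop. 7 (1.145) p.100, Thm 8 (1.146) p.101 (the `b8` block, any currency); Balaban1985UV3, Thm 1 p.257 + Thm 2 p.272; Balaban1985BackgroundPropagators, Thm 3.1 p.397; Balaban1985Variational, Thm 1 p.279 + Thm 3 p.278; Balaban1988Convergent, Thm 1 p.262, Thm 2 p.263, p.244; Balaban1987RG1, Lemma 4 p.291, Thm 3 p.264; Balaban1988RG2Cluster, Lemmas 1–3 pp.9–20; Balaban1989LargeFieldI, (0.4) p.176 (bookkeeping)] -/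
theorem N24_nodes₁₃CoPH_rebindX_withB8_fourPin_pointed (θ : Stage13HParams F N) (hP : θ.Provisos₁₃CoPH F N) (hθ : θ.Admissible F N)
    (X' : B12.RunParams → PrintedCarriersR) (Mstar : ℕ) (ops : OpsY N θ.toStage3Params Mstar) (ζ : ResidZ F N) (lamW : ResidW F N)
    (b8sel : B12.RunParams → Prop) (w : WorldP)
    (hC : w.C = (datumOfRecord₁₃CoPH F N θ hP).C) (hγ : 0 < w.γ ∧ w.γ ≤ θ.γ) (hL : w.L = (θ.L : ℝ))
    (hup : ∀ P, w.up P = (upOfRecord₅C F N ((θ.rebindX F N X').view₁₃CoPHB10YZW F N Mstar ops ζ lamW) P).withB8 (b8sel P))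
    (h05G : ∀ P : B12.RunParams, b8sel P)
    (h06 : B9LeafX (Y9OfRecord N θ.toStage3Params Mstar ops))
    (h07 : B11Leaf (Z11OfRecord F N ζ))
    (h08 : PrintedUV3V N θ.L)
    (h09 : ∀ P : B12.RunParams, B12Sec2to5.Lemma4Printed (X' P).F12 (X' P).c12)
    (h09T : ∀ P : B12.RunParams, (leavesP w P).smallCouplings → (leavesP w P).smallFieldInductive)
    (h10 : ∀ P : B12.RunParams, B9LeafX (Y9OfRecord N θ.toStage3Params Mstar ops) →
      (B10.Thm1PrintedCompact (((θ.rebindX F N X').view₁₃CoPHB10YZW F N Mstar ops ζ lamW).res.X P).runs10 ∧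
          B10.Thm2Printed (((θ.rebindX F N X').view₁₃CoPHB10YZW F N Mstar ops ζ lamW).res.X P).runs10) →
        B11Leaf (Z11OfRecord F N ζ) → B12Sec2to5.Lemma4Printed (X' P).F12 (X' P).c12 →
          B13.Lemma1Printed (X' P).S13 (X' P).c13 ∧ B13.Lemma2Printed (X' P).S13 (X' P).c13 ∧
            B13.Lemma3Printed (X' P).S13 (X' P).c13)
    (h11 : ∀ P : B12.RunParams, (leavesP w P).b7 → (leavesP w P).b8 → (leavesP w P).b9 → (leavesP w P).b10 → (leavesP w P).b11 →
      (leavesP w P).smallCouplings → (leavesP w P).smallFieldInductive → (leavesP w P).flowControl →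
        ∀ k, k < P.K → SLaw₁₃CoPH F N θ P k → TLaw₁₃CoPH F N θ P k)
    (h12 : ∀ P : B12.RunParams, B15Leaf (WOfRecord₁₃ F N θ.toStage13Params lamW P))
    (hR : ∀ (P : B12.RunParams) (k : ℕ), k < P.K → TLaw₁₃CoPH F N θ P k → SLaw₁₃CoPH F N θ P (k + 1))
    (hUV : ∀ P : B12.RunParams, (genFlow (betaOfRecord₁₃ F N θ.toStage13Params) P.g0).InInterval w.γ P.K → ∀ k, k ≤ P.K → SLaw₁₃CoPH F N θ P k →
      ∀ U : GaugeField (F.P P.K) k (SU N),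
        chiβOfRecord₁₃ F N θ.toStage13Params P.K (gOfRecord₁₃ F N θ.toStage13Params P) k U *
              Real.exp (-(1 / (gOfRecord₁₃ F N θ.toStage13Params P k) ^ 2 * wilsonBGOfRecord F N θ.εbg P k U)
                - w.em (gOfRecord₁₃ F N θ.toStage13Params P k) * (Fintype.card (Site (F.P P.K) k) : ℝ)) ≤ densOfRecord₁₃ F N θ.toStage13Params P k U ∧
        densOfRecord₁₃ F N θ.toStage13Params P k U ≤ Real.exp (w.ep (gOfRecord₁₃ F N θ.toStage13Params P k) * (Fintype.card (Site (F.P P.K) k) : ℝ))) :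
    ∀ P : B12.RunParams, Nodes (leavesP w P) := by
  intro P
  have hrec' := N24_isRecordOfRecord₁₃CCoPH_twin_of_upS_rebindX_view θ hP hθ X' Mstar ops ζ lamW w hC hγ hL
  have hw8 : ∀ P, w.up P = (upOfRecord₅C F N ((θ.rebindX F N X').view₁₃CoPHB10YZW F N Mstar ops ζ lamW) P).withB8 (leavesP w P).b8 := fun P => by
    show w.up P = (upOfRecord₅C F N _ P).withB8 (w.up P).b8
    rw [hup P]
    rfl
  have hleaves := leavesP_eq_of_up_withB8 hw8 P
  have h4 : Dag.B4_main (leavesP w P) := by rw [hleaves]; exact b4_main_of_isRecordOfRecord₁₃CCoPH hrec' P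
  have h5 : Dag.B5_main (leavesP w P) := by rw [hleaves]; exact b5_main_of_isRecordOfRecord₁₃CCoPH hrec' P
  have h6 : Dag.B6_main (leavesP w P) := by rw [hleaves]; exact N24_b6_main_of_isRecordOfRecord₁₃CCoPH hrec' P
  have h7 : Dag.B7_main (leavesP w P) := by rw [hleaves]; exact b7_main_of_isRecordOfRecord₁₃CCoPH hrec' P
  have hl := upOfRecord₅C_view₁₃CoPHB10YZW_leaves F N (θ.rebindX F N X') Mstar ops ζ lamW P
  have h8 : (w.up P).b8 := by
    rw [hup P]; exact h05G P
  have h9 : (w.up P).b9 := by rw [hup P]; exact hl.2.1.2 h06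
  have h10leaf : (w.up P).b10 := by rw [hup P]; exact hl.2.2.1.2 h08
  have h11leaf : (w.up P).b11 := by rw [hup P]; exact hl.2.2.2.2 h07
  have h15 : (w.up P).rBasicStep := by rw [hup P]; exact hl.1.2 (h12 P)
  have h12leaf : (leavesP w P).b12 := by
    show (w.up P).b12
    rw [hup P]; exact h09 P
  have h13 : Dag.B13_main (leavesP w P) := by
    have h' : Dag.B13_main (leavesP { w with up := fun P => upOfRecord₅C F N ((θ.rebindX F N X').view₁₃CoPHB10YZW F N Mstar ops ζ lamW) P } P) :=
      B13NodeKnitRecord5C.b13_main_at_stage5ParamsC F N ((θ.rebindX F N X').view₁₃CoPHB10YZW F N Mstar ops ζ lamW) _ P rfl (h10 P)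
    show (w.up P).b9 → (w.up P).b10 → (w.up P).b11 → (w.up P).b12 → (w.up P).b13
    rw [hup P]
    exact h'
  have hrop := N24_rOperation_iff_of_up_withB8_rebindX_view_coPH θ X' Mstar ops ζ lamW (hup P)
  exact ⟨h4, h5, h6, h7, B8LeafKnit.b8_main_of_leaf w P h8, fun _ _ _ _ => h9, fun _ _ _ _ _ _ => h10leaf,
    fun _ _ _ _ _ => h11leaf, B12NodeKnitRecord8.b12_main_of_leaf_of_thm3Member h12leaf (h09T P), h13,
    b14_main_at_construction_rhoOfRecord9_along F N (coreOfRecord₁₃CoPH F N θ) w P θ.ν θ.τ9 (EOfRecord₁₃ F N θ.toStage13Params) (wOfRecord₉ F N θ.toStage9Params) θ.ppSel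
      (gOfRecord₁₃ F N θ.toStage13Params) (fun p k _ => SLaw₁₃CoPH F N θ p k) (fun p k _ => TLaw₁₃CoPH F N θ p k) (hC.trans (datumOfRecord₁₃CoPH_C F N θ hP))
      (fun _ _ => Iff.rfl) (fun _ => sLaw₁₃CoPH_zero F N θ P) (h11 P) (fun hr => hrop.1 hr),
    B15LeafKnit.b15_main_of_up (U := w.up P) rfl h15,
    b16_main_at_repTowerOfRecord_along F N (coreOfRecord₁₃CoPH F N θ) w P θ.ν θ.τ9 (EOfRecord₁₃ F N θ.toStage13Params) (wOfRecord₉ F N θ.toStage9Params) θ.ppSel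
      (gOfRecord₁₃ F N θ.toStage13Params) (fun k _ => SLaw₁₃CoPH F N θ P k) (fun k _ => TLaw₁₃CoPH F N θ P k) (hC.trans (datumOfRecord₁₃CoPH_C F N θ hP))
      (fun _ _ => Iff.rfl) hrop.2 (hR P) le_rfl (hUV P)⟩

/-! ## §2. (B) at the datum and item K1⁷'s θ-keyed consequent, at a world bound to the four-pin view of `θ.rebindX X'` with the `b8` block re-bound -/

/-- **N24 · (B2) AT `(datumOfRecord₁₃CoPH θ hP).C` FROM THE POINTED CHILDREN, N05 READ AS `b8sel`, AND THE β-BOX PAIR** (Core-keyed): node00-def-T's headline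
`endStatementBPrinted_of_nodesP_interval_guarded` AT THE RE-BOUND WORLD (no record predicate reads the binding) — nodes by §1, the guarded (0.20) and the β-window from the C-bound
twin record (`rgFlow_of_smallCouplings_of_isRecordOfRecord₁₃CCoPH`, `N24_betaBoundsInInterval_of_isRecordOfRecord₁₃CCoPH_of_boxH`; both read `w.C`, `w.γ` only). [cite: Balaban1989LargeFieldII, Thm 1 p.355 + p.391; Balaban1987RG1, (0.20) p.256, (1.22) p.264; Balaban1985RegularSpaces, Thm 8 (1.146) p.101 (bookkeeping + elementary window)] -/
theorem N24_endStatementBPrinted₁₃CoPH_rebindX_withB8_fourPin_pointed (θ : Stage13HParams F N) (hP : θ.Provisos₁₃CoPH F N) (hθ : θ.Admissible F N)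
    (X' : B12.RunParams → PrintedCarriersR) (Mstar : ℕ) (ops : OpsY N θ.toStage3Params Mstar) (ζ : ResidZ F N) (lamW : ResidW F N)
    (b8sel : B12.RunParams → Prop) (w : WorldP)
    (hC : w.C = (datumOfRecord₁₃CoPH F N θ hP).C) (hγ : 0 < w.γ ∧ w.γ ≤ θ.γ) (hL : w.L = (θ.L : ℝ))
    (hup : ∀ P, w.up P = (upOfRecord₅C F N ((θ.rebindX F N X').view₁₃CoPHB10YZW F N Mstar ops ζ lamW) P).withB8 (b8sel P))
    (h05G : ∀ P : B12.RunParams, b8sel P)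
    (h06 : B9LeafX (Y9OfRecord N θ.toStage3Params Mstar ops))
    (h07 : B11Leaf (Z11OfRecord F N ζ))
    (h08 : PrintedUV3V N θ.L)
    (h09 : ∀ P : B12.RunParams, B12Sec2to5.Lemma4Printed (X' P).F12 (X' P).c12)
    (h09T : ∀ P : B12.RunParams, (leavesP w P).smallCouplings → (leavesP w P).smallFieldInductive)
    (h10 : ∀ P : B12.RunParams, B9LeafX (Y9OfRecord N θ.toStage3Params Mstar ops) →
      (B10.Thm1PrintedCompact (((θ.rebindX F N X').view₁₃CoPHB10YZW F N Mstar ops ζ lamW).res.X P).runs10 ∧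
          B10.Thm2Printed (((θ.rebindX F N X').view₁₃CoPHB10YZW F N Mstar ops ζ lamW).res.X P).runs10) →
        B11Leaf (Z11OfRecord F N ζ) → B12Sec2to5.Lemma4Printed (X' P).F12 (X' P).c12 →
          B13.Lemma1Printed (X' P).S13 (X' P).c13 ∧ B13.Lemma2Printed (X' P).S13 (X' P).c13 ∧
            B13.Lemma3Printed (X' P).S13 (X' P).c13)
    (h11 : ∀ P : B12.RunParams, (leavesP w P).b7 → (leavesP w P).b8 → (leavesP w P).b9 → (leavesP w P).b10 → (leavesP w P).b11 →
      (leavesP w P).smallCouplings → (leavesP w P).smallFieldInductive → (leavesP w P).flowControl →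
        ∀ k, k < P.K → SLaw₁₃CoPH F N θ P k → TLaw₁₃CoPH F N θ P k)
    (h12 : ∀ P : B12.RunParams, B15Leaf (WOfRecord₁₃ F N θ.toStage13Params lamW P))
    (hR : ∀ (P : B12.RunParams) (k : ℕ), k < P.K → TLaw₁₃CoPH F N θ P k → SLaw₁₃CoPH F N θ P (k + 1))
    (hUV : ∀ P : B12.RunParams, (genFlow (betaOfRecord₁₃ F N θ.toStage13Params) P.g0).InInterval w.γ P.K → ∀ k, k ≤ P.K → SLaw₁₃CoPH F N θ P k →
      ∀ U : GaugeField (F.P P.K) k (SU N),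
        chiβOfRecord₁₃ F N θ.toStage13Params P.K (gOfRecord₁₃ F N θ.toStage13Params P) k U *
              Real.exp (-(1 / (gOfRecord₁₃ F N θ.toStage13Params P k) ^ 2 * wilsonBGOfRecord F N θ.εbg P k U)
                - w.em (gOfRecord₁₃ F N θ.toStage13Params P k) * (Fintype.card (Site (F.P P.K) k) : ℝ)) ≤ densOfRecord₁₃ F N θ.toStage13Params P k U ∧
        densOfRecord₁₃ F N θ.toStage13Params P k U ≤ Real.exp (w.ep (gOfRecord₁₃ F N θ.toStage13Params P k) * (Fintype.card (Site (F.P P.K) k) : ℝ))) 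
    (hlo : BetaLowerH w.b w.γ (datumOfRecord₁₃CoPH F N θ hP).βfun) (hhi : BetaUpperH w.βup w.γ (datumOfRecord₁₃CoPH F N θ hP).βfun) :
    B16.EndStatementBPrinted (datumOfRecord₁₃CoPH F N θ hP).C := by
  have hrec' := N24_isRecordOfRecord₁₃CCoPH_twin_of_upS_rebindX_view θ hP hθ X' Mstar ops ζ lamW w hC hγ hL
  have hn := N24_nodes₁₃CoPH_rebindX_withB8_fourPin_pointed θ hP hθ X' Mstar ops ζ lamW b8sel w hC hγ hL hup h05G h06 h07 h08 h09 h09T h10 h11 h12 hR hUV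
  rw [← hC]
  exact endStatementBPrinted_of_nodesP_interval_guarded w hγ.1 le_rfl hn (fun P hsc => rgFlow_of_smallCouplings_of_isRecordOfRecord₁₃CCoPH hrec' P hsc)
    (N24_betaBoundsInInterval_of_isRecordOfRecord₁₃CCoPH_of_boxH hrec' hlo hhi)

/-- **★ ITEM K1⁷ (stmt-QuantumFields-20542)'s θ-KEYED CONSEQUENT, WITNESSED BY `(θ, hP)`, FROM THE POINTED CHILDREN WITH N05 READ AS `b8sel`** — the world bound to the four-pin view
of `θ.rebindX X'` with the `b8` block re-bound, guard `hU` displayed; (B) by the previous theorem at `hP.toCore`, window by module 26's `N24_window_of_betaUpperH`.  COMPOSITE: nothing is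
discharged; the item's TEXT reads no world, hence no binding. [cite: Balaban1989LargeFieldII, Thm 1 p.355, (0.1) pp.355–356, p.391; Balaban1985RegularSpaces, Prop. 7 (1.145) p.100, Thm 8 (1.146) p.101; Balaban1987RG1, Thm 3 p.264, (0.17)–(0.20) pp.255–256 and (1.22) p.264; Balaban1985UV3, Thm 1 p.257 (bookkeeping + elementary window)] -/
theorem N24_stabilityBR13SepCoPH_thetaShape20_rebindX_withB8_fourPin_pointed (θ : Stage13HParams F N) (hP : θ.Provisos₁₃SepCoPH F N) (hθ : θ.Admissible F N)
    (hU : θ.ZhUnity F N ∧ θ.SlotsNondegenerate₁₃ F N)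
    (X' : B12.RunParams → PrintedCarriersR) (Mstar : ℕ) (ops : OpsY N θ.toStage3Params Mstar) (ζ : ResidZ F N) (lamW : ResidW F N)
    (b8sel : B12.RunParams → Prop) (w : WorldP)
    (hC : w.C = (datumOfRecord₁₃SepCoPH F N θ hP).C) (hγ : 0 < w.γ ∧ w.γ ≤ θ.γ) (hL : w.L = (θ.L : ℝ))
    (hup : ∀ P, w.up P = (upOfRecord₅C F N ((θ.rebindX F N X').view₁₃CoPHB10YZW F N Mstar ops ζ lamW) P).withB8 (b8sel P))
    (h05G : ∀ P : B12.RunParams, b8sel P)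
    (h06 : B9LeafX (Y9OfRecord N θ.toStage3Params Mstar ops))
    (h07 : B11Leaf (Z11OfRecord F N ζ))
    (h08 : PrintedUV3V N θ.L)
    (h09 : ∀ P : B12.RunParams, B12Sec2to5.Lemma4Printed (X' P).F12 (X' P).c12)
    (h09T : ∀ P : B12.RunParams, (leavesP w P).smallCouplings → (leavesP w P).smallFieldInductive)
    (h10 : ∀ P : B12.RunParams, B9LeafX (Y9OfRecord N θ.toStage3Params Mstar ops) →
      (B10.Thm1PrintedCompact (((θ.rebindX F N X').view₁₃CoPHB10YZW F N Mstar ops ζ lamW).res.X P).runs10 ∧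
          B10.Thm2Printed (((θ.rebindX F N X').view₁₃CoPHB10YZW F N Mstar ops ζ lamW).res.X P).runs10) →
        B11Leaf (Z11OfRecord F N ζ) → B12Sec2to5.Lemma4Printed (X' P).F12 (X' P).c12 →
          B13.Lemma1Printed (X' P).S13 (X' P).c13 ∧ B13.Lemma2Printed (X' P).S13 (X' P).c13 ∧
            B13.Lemma3Printed (X' P).S13 (X' P).c13)
    (h11 : ∀ P : B12.RunParams, (leavesP w P).b7 → (leavesP w P).b8 → (leavesP w P).b9 → (leavesP w P).b10 → (leavesP w P).b11 →
      (leavesP w P).smallCouplings → (leavesP w P).smallFieldInductive → (leavesP w P).flowControl →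
        ∀ k, k < P.K → SLaw₁₃CoPH F N θ P k → TLaw₁₃CoPH F N θ P k)
    (h12 : ∀ P : B12.RunParams, B15Leaf (WOfRecord₁₃ F N θ.toStage13Params lamW P))
    (hR : ∀ (P : B12.RunParams) (k : ℕ), k < P.K → TLaw₁₃CoPH F N θ P k → SLaw₁₃CoPH F N θ P (k + 1))
    (hUV : ∀ P : B12.RunParams, (genFlow (betaOfRecord₁₃ F N θ.toStage13Params) P.g0).InInterval w.γ P.K → ∀ k, k ≤ P.K → SLaw₁₃CoPH F N θ P k →
      ∀ U : GaugeField (F.P P.K) k (SU N),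
        chiβOfRecord₁₃ F N θ.toStage13Params P.K (gOfRecord₁₃ F N θ.toStage13Params P) k U *
              Real.exp (-(1 / (gOfRecord₁₃ F N θ.toStage13Params P k) ^ 2 * wilsonBGOfRecord F N θ.εbg P k U)
                - w.em (gOfRecord₁₃ F N θ.toStage13Params P k) * (Fintype.card (Site (F.P P.K) k) : ℝ)) ≤ densOfRecord₁₃ F N θ.toStage13Params P k U ∧
        densOfRecord₁₃ F N θ.toStage13Params P k U ≤ Real.exp (w.ep (gOfRecord₁₃ F N θ.toStage13Params P k) * (Fintype.card (Site (F.P P.K) k) : ℝ))) 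
    (hlo : BetaLowerH w.b w.γ (datumOfRecord₁₃SepCoPH F N θ hP).βfun) (hhi : BetaUpperH w.βup w.γ (datumOfRecord₁₃SepCoPH F N θ hP).βfun) :
    ∃ (θ' : Stage13HParams F N) (h' : θ'.Provisos₁₃SepCoPH F N), (θ'.ZhUnity F N ∧ θ'.SlotsNondegenerate₁₃ F N) ∧ θ'.Admissible F N ∧
      B16.EndStatementBPrinted (datumOfRecord₁₃SepCoPH F N θ' h').C ∧
      ∃ γ₁ : ℝ, 0 < γ₁ ∧ ∀ γ : ℝ, 0 < γ → γ ≤ γ₁ → ∃ P : B12.RunParams, 1 ≤ P.K ∧ ((datumOfRecord₁₃SepCoPH F N θ' h').C P).flow.InInterval γ P.K :=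
  ⟨θ, hP, hU, hθ, N24_endStatementBPrinted₁₃CoPH_rebindX_withB8_fourPin_pointed θ hP.toCore hθ X' Mstar ops ζ lamW b8sel w hC hγ hL hup h05G h06 h07 h08 h09 h09T h10 h11 h12 hR hUV hlo hhi,
    N24_window_of_betaUpperH _ hγ.1 hhi⟩

/-! ## §3. THE SC INSTANCES: worlds bound by dag-n05-w1's repaired-currency «P₂C» binding `upOfRecord₅CSC … C₇` (`= (upOfRecord₅C …).withB8 (B8LeafRSC … C₇ …)`, `rfl`) -/

/-- **N24 · THE THIRTEEN NODES AT A WORLD SC-BOUND TO THE FOUR-PIN VIEW OF `θ.rebindX X'`** (dag-n05-w1's `upOfRecord₅CSC … C₇`; §1 at `b8sel P := (upOfRecord₅CSC … C₇ P).b8`,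
`rfl` on the definition): **N05 ← `h05SC`, the SC-binding's `b8`** — at dag-n05-w4's X-P₂C pin `X' := XPinned₁₃P₂C θ λ₈ λ₁₂ λ₁₃`, `C₇ := c₇OfRecord θ₃` it IS the slot
`B8LeafOfRecordSubBP₂C θ₃ λ₈` (`Record13CarriersXPinnedP2CSViewCoPH.socket05SC_view₁₃CoPHB10YZW_pinX3P₂C_iff`, `Iff.rfl`; their class `IsRecordOfRecord₁₃CSepCoPHSX3P₂CV`).  The other
twelve slots as in §1. [cite: Balaban1989LargeFieldII, Thm 1 p.355, (0.1) pp.355–356, p.387, p.391; Balaban1985RegularSpaces, Lemma 1 – Thm 8 pp.79–101, Prop. 7 (1.145) p.100, Thm 8 (1.146) p.101 (the `b8` block, any currency); Balaban1985UV3, Thm 1 p.257 + Thm 2 p.272; Balaban1985BackgroundPropagators, Thm 3.1 p.397; Balaban1985Variational, Thm 1 p.279 + Thm 3 p.278; Balaban1988Convergent, Thm 1 p.262, Thm 2 p.263, p.244; Balaban1987RG1, Lemma 4 p.291, Thm 3 p.264; Balaban1988RG2Cluster, Lemmas 1–3 pp.9–20; Balaban1989LargeFieldI, (0.4) p.176 (bookkeeping)]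 -/
theorem N24_nodes₁₃CoPH_rebindXSC_fourPin_pointed (θ : Stage13HParams F N) (hP : θ.Provisos₁₃CoPH F N) (hθ : θ.Admissible F N)
    (X' : B12.RunParams → PrintedCarriersR) (Mstar : ℕ) (ops : OpsY N θ.toStage3Params Mstar) (ζ : ResidZ F N) (lamW : ResidW F N)
    (C₇ : ℝ) (w : WorldP)
    (hC : w.C = (datumOfRecord₁₃CoPH F N θ hP).C) (hγ : 0 < w.γ ∧ w.γ ≤ θ.γ) (hL : w.L = (θ.L : ℝ))
    (hup : ∀ P, w.up P = upOfRecord₅CSC F N ((θ.rebindX F N X').view₁₃CoPHB10YZW F N Mstar ops ζ lamW) C₇ P)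
    (h05SC : ∀ P : B12.RunParams, (upOfRecord₅CSC F N ((θ.rebindX F N X').view₁₃CoPHB10YZW F N Mstar ops ζ lamW) C₇ P).b8)
    (h06 : B9LeafX (Y9OfRecord N θ.toStage3Params Mstar ops))
    (h07 : B11Leaf (Z11OfRecord F N ζ))
    (h08 : PrintedUV3V N θ.L)
    (h09 : ∀ P : B12.RunParams, B12Sec2to5.Lemma4Printed (X' P).F12 (X' P).c12)
    (h09T : ∀ P : B12.RunParams, (leavesP w P).smallCouplings → (leavesP w P).smallFieldInductive)
    (h10 : ∀ P : B12.RunParams, B9LeafX (Y9OfRecord N θ.toStage3Params Mstar ops) →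
      (B10.Thm1PrintedCompact (((θ.rebindX F N X').view₁₃CoPHB10YZW F N Mstar ops ζ lamW).res.X P).runs10 ∧
          B10.Thm2Printed (((θ.rebindX F N X').view₁₃CoPHB10YZW F N Mstar ops ζ lamW).res.X P).runs10) →
        B11Leaf (Z11OfRecord F N ζ) → B12Sec2to5.Lemma4Printed (X' P).F12 (X' P).c12 →
          B13.Lemma1Printed (X' P).S13 (X' P).c13 ∧ B13.Lemma2Printed (X' P).S13 (X' P).c13 ∧
            B13.Lemma3Printed (X' P).S13 (X' P).c13)
    (h11 : ∀ P : B12.RunParams, (leavesP w P).b7 → (leavesP w P).b8 → (leavesP w P).b9 → (leavesP w P).b10 → (leavesP w P).b11 →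
      (leavesP w P).smallCouplings → (leavesP w P).smallFieldInductive → (leavesP w P).flowControl →
        ∀ k, k < P.K → SLaw₁₃CoPH F N θ P k → TLaw₁₃CoPH F N θ P k)
    (h12 : ∀ P : B12.RunParams, B15Leaf (WOfRecord₁₃ F N θ.toStage13Params lamW P))
    (hR : ∀ (P : B12.RunParams) (k : ℕ), k < P.K → TLaw₁₃CoPH F N θ P k → SLaw₁₃CoPH F N θ P (k + 1))
    (hUV : ∀ P : B12.RunParams, (genFlow (betaOfRecord₁₃ F N θ.toStage13Params) P.g0).InInterval w.γ P.K → ∀ k, k ≤ P.K → SLaw₁₃CoPH F N θ P k →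
      ∀ U : GaugeField (F.P P.K) k (SU N),
        chiβOfRecord₁₃ F N θ.toStage13Params P.K (gOfRecord₁₃ F N θ.toStage13Params P) k U *
              Real.exp (-(1 / (gOfRecord₁₃ F N θ.toStage13Params P k) ^ 2 * wilsonBGOfRecord F N θ.εbg P k U)
                - w.em (gOfRecord₁₃ F N θ.toStage13Params P k) * (Fintype.card (Site (F.P P.K) k) : ℝ)) ≤ densOfRecord₁₃ F N θ.toStage13Params P k U ∧
        densOfRecord₁₃ F N θ.toStage13Params P k U ≤ Real.exp (w.ep (gOfRecord₁₃ F N θ.toStage13Params P k) * (Fintype.card (Site (F.P P.K) k) : ℝ))) :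
    ∀ P : B12.RunParams, Nodes (leavesP w P) :=
  N24_nodes₁₃CoPH_rebindX_withB8_fourPin_pointed θ hP hθ X' Mstar ops ζ lamW (fun P => (upOfRecord₅CSC F N ((θ.rebindX F N X').view₁₃CoPHB10YZW F N Mstar ops ζ lamW) C₇ P).b8) w hC hγ hL
    (fun P => by rw [hup P]; rfl) h05SC h06 h07 h08 h09 h09T h10 h11 h12 hR hUV

/-- **N24 · (B2) AT THE DATUM FROM THE POINTED CHILDREN AT AN SC-BOUND WORLD** (§2 at the SC binding, `rfl`). [cite: Balaban1989LargeFieldII, Thm 1 p.355 + p.391; Balaban1987RG1, (0.20) p.256, (1.22) p.264; Balaban1985RegularSpaces, Thm 8 (1.146) p.101 (bookkeeping + elementary window)] -/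
theorem N24_endStatementBPrinted₁₃CoPH_rebindXSC_fourPin_pointed (θ : Stage13HParams F N) (hP : θ.Provisos₁₃CoPH F N) (hθ : θ.Admissible F N)
    (X' : B12.RunParams → PrintedCarriersR) (Mstar : ℕ) (ops : OpsY N θ.toStage3Params Mstar) (ζ : ResidZ F N) (lamW : ResidW F N)
    (C₇ : ℝ) (w : WorldP)
    (hC : w.C = (datumOfRecord₁₃CoPH F N θ hP).C) (hγ : 0 < w.γ ∧ w.γ ≤ θ.γ) (hL : w.L = (θ.L : ℝ))
    (hup : ∀ P, w.up P = upOfRecord₅CSC F N ((θ.rebindX F N X').view₁₃CoPHB10YZW F N Mstar ops ζ lamW) C₇ P)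
    (h05SC : ∀ P : B12.RunParams, (upOfRecord₅CSC F N ((θ.rebindX F N X').view₁₃CoPHB10YZW F N Mstar ops ζ lamW) C₇ P).b8)
    (h06 : B9LeafX (Y9OfRecord N θ.toStage3Params Mstar ops))
    (h07 : B11Leaf (Z11OfRecord F N ζ))
    (h08 : PrintedUV3V N θ.L)
    (h09 : ∀ P : B12.RunParams, B12Sec2to5.Lemma4Printed (X' P).F12 (X' P).c12)
    (h09T : ∀ P : B12.RunParams, (leavesP w P).smallCouplings → (leavesP w P).smallFieldInductive)
    (h10 : ∀ P : B12.RunParams, B9LeafX (Y9OfRecord N θ.toStage3Params Mstar ops) →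
      (B10.Thm1PrintedCompact (((θ.rebindX F N X').view₁₃CoPHB10YZW F N Mstar ops ζ lamW).res.X P).runs10 ∧
          B10.Thm2Printed (((θ.rebindX F N X').view₁₃CoPHB10YZW F N Mstar ops ζ lamW).res.X P).runs10) →
        B11Leaf (Z11OfRecord F N ζ) → B12Sec2to5.Lemma4Printed (X' P).F12 (X' P).c12 →
          B13.Lemma1Printed (X' P).S13 (X' P).c13 ∧ B13.Lemma2Printed (X' P).S13 (X' P).c13 ∧
            B13.Lemma3Printed (X' P).S13 (X' P).c13)
    (h11 : ∀ P : B12.RunParams, (leavesP w P).b7 → (leavesP w P).b8 → (leavesP w P).b9 → (leavesP w P).b10 → (leavesP w P).b11 →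
      (leavesP w P).smallCouplings → (leavesP w P).smallFieldInductive → (leavesP w P).flowControl →
        ∀ k, k < P.K → SLaw₁₃CoPH F N θ P k → TLaw₁₃CoPH F N θ P k)
    (h12 : ∀ P : B12.RunParams, B15Leaf (WOfRecord₁₃ F N θ.toStage13Params lamW P))
    (hR : ∀ (P : B12.RunParams) (k : ℕ), k < P.K → TLaw₁₃CoPH F N θ P k → SLaw₁₃CoPH F N θ P (k + 1))
    (hUV : ∀ P : B12.RunParams, (genFlow (betaOfRecord₁₃ F N θ.toStage13Params) P.g0).InInterval w.γ P.K → ∀ k, k ≤ P.K → SLaw₁₃CoPH F N θ P k →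
      ∀ U : GaugeField (F.P P.K) k (SU N),
        chiβOfRecord₁₃ F N θ.toStage13Params P.K (gOfRecord₁₃ F N θ.toStage13Params P) k U *
              Real.exp (-(1 / (gOfRecord₁₃ F N θ.toStage13Params P k) ^ 2 * wilsonBGOfRecord F N θ.εbg P k U)
                - w.em (gOfRecord₁₃ F N θ.toStage13Params P k) * (Fintype.card (Site (F.P P.K) k) : ℝ)) ≤ densOfRecord₁₃ F N θ.toStage13Params P k U ∧
        densOfRecord₁₃ F N θ.toStage13Params P k U ≤ Real.exp (w.ep (gOfRecord₁₃ F N θ.toStage13Params P k) * (Fintype.card (Site (F.P P.K) k) : ℝ))) 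
    (hlo : BetaLowerH w.b w.γ (datumOfRecord₁₃CoPH F N θ hP).βfun) (hhi : BetaUpperH w.βup w.γ (datumOfRecord₁₃CoPH F N θ hP).βfun) :
    B16.EndStatementBPrinted (datumOfRecord₁₃CoPH F N θ hP).C :=
  N24_endStatementBPrinted₁₃CoPH_rebindX_withB8_fourPin_pointed θ hP hθ X' Mstar ops ζ lamW (fun P => (upOfRecord₅CSC F N ((θ.rebindX F N X').view₁₃CoPHB10YZW F N Mstar ops ζ lamW) C₇ P).b8) w hC hγ hL
    (fun P => by rw [hup P]; rfl) h05SC h06 h07 h08 h09 h09T h10 h11 h12 hR hUV hlo hhi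

/-- **★ ITEM K1⁷'s θ-KEYED CONSEQUENT AT AN SC-BOUND WORLD** (§2's item-facing form at the SC binding, `rfl`) — the form dag-n05-w4's P₂C records ∕ storeys present. [cite: Balaban1989LargeFieldII, Thm 1 p.355, (0.1) pp.355–356, p.391; Balaban1985RegularSpaces, Prop. 7 (1.145) p.100, Thm 8 (1.146) p.101; Balaban1987RG1, Thm 3 p.264, (0.17)–(0.20) pp.255–256 and (1.22) p.264; Balaban1985UV3, Thm 1 p.257 (bookkeeping + elementary window)] -/
theorem N24_stabilityBR13SepCoPH_thetaShape20_rebindXSC_fourPin_pointed (θ : Stage13HParams F N) (hP : θ.Provisos₁₃SepCoPH F N) (hθ : θ.Admissible F N)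
    (hU : θ.ZhUnity F N ∧ θ.SlotsNondegenerate₁₃ F N)
    (X' : B12.RunParams → PrintedCarriersR) (Mstar : ℕ) (ops : OpsY N θ.toStage3Params Mstar) (ζ : ResidZ F N) (lamW : ResidW F N)
    (C₇ : ℝ) (w : WorldP)
    (hC : w.C = (datumOfRecord₁₃SepCoPH F N θ hP).C) (hγ : 0 < w.γ ∧ w.γ ≤ θ.γ) (hL : w.L = (θ.L : ℝ))
    (hup : ∀ P, w.up P = upOfRecord₅CSC F N ((θ.rebindX F N X').view₁₃CoPHB10YZW F N Mstar ops ζ lamW) C₇ P)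
    (h05SC : ∀ P : B12.RunParams, (upOfRecord₅CSC F N ((θ.rebindX F N X').view₁₃CoPHB10YZW F N Mstar ops ζ lamW) C₇ P).b8)
    (h06 : B9LeafX (Y9OfRecord N θ.toStage3Params Mstar ops))
    (h07 : B11Leaf (Z11OfRecord F N ζ))
    (h08 : PrintedUV3V N θ.L)
    (h09 : ∀ P : B12.RunParams, B12Sec2to5.Lemma4Printed (X' P).F12 (X' P).c12)
    (h09T : ∀ P : B12.RunParams, (leavesP w P).smallCouplings → (leavesP w P).smallFieldInductive)
    (h10 : ∀ P : B12.RunParams, B9LeafX (Y9OfRecord N θ.toStage3Params Mstar ops) →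
      (B10.Thm1PrintedCompact (((θ.rebindX F N X').view₁₃CoPHB10YZW F N Mstar ops ζ lamW).res.X P).runs10 ∧
          B10.Thm2Printed (((θ.rebindX F N X').view₁₃CoPHB10YZW F N Mstar ops ζ lamW).res.X P).runs10) →
        B11Leaf (Z11OfRecord F N ζ) → B12Sec2to5.Lemma4Printed (X' P).F12 (X' P).c12 →
          B13.Lemma1Printed (X' P).S13 (X' P).c13 ∧ B13.Lemma2Printed (X' P).S13 (X' P).c13 ∧
            B13.Lemma3Printed (X' P).S13 (X' P).c13)
    (h11 : ∀ P : B12.RunParams, (leavesP w P).b7 → (leavesP w P).b8 → (leavesP w P).b9 → (leavesP w P).b10 → (leavesP w P).b11 →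
      (leavesP w P).smallCouplings → (leavesP w P).smallFieldInductive → (leavesP w P).flowControl →
        ∀ k, k < P.K → SLaw₁₃CoPH F N θ P k → TLaw₁₃CoPH F N θ P k)
    (h12 : ∀ P : B12.RunParams, B15Leaf (WOfRecord₁₃ F N θ.toStage13Params lamW P))
    (hR : ∀ (P : B12.RunParams) (k : ℕ), k < P.K → TLaw₁₃CoPH F N θ P k → SLaw₁₃CoPH F N θ P (k + 1))
    (hUV : ∀ P : B12.RunParams, (genFlow (betaOfRecord₁₃ F N θ.toStage13Params) P.g0).InInterval w.γ P.K → ∀ k, k ≤ P.K → SLaw₁₃CoPH F N θ P k →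
      ∀ U : GaugeField (F.P P.K) k (SU N),
        chiβOfRecord₁₃ F N θ.toStage13Params P.K (gOfRecord₁₃ F N θ.toStage13Params P) k U *
              Real.exp (-(1 / (gOfRecord₁₃ F N θ.toStage13Params P k) ^ 2 * wilsonBGOfRecord F N θ.εbg P k U)
                - w.em (gOfRecord₁₃ F N θ.toStage13Params P k) * (Fintype.card (Site (F.P P.K) k) : ℝ)) ≤ densOfRecord₁₃ F N θ.toStage13Params P k U ∧
        densOfRecord₁₃ F N θ.toStage13Params P k U ≤ Real.exp (w.ep (gOfRecord₁₃ F N θ.toStage13Params P k) * (Fintype.card (Site (F.P P.K) k) : ℝ))) 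
    (hlo : BetaLowerH w.b w.γ (datumOfRecord₁₃SepCoPH F N θ hP).βfun) (hhi : BetaUpperH w.βup w.γ (datumOfRecord₁₃SepCoPH F N θ hP).βfun) :
    ∃ (θ' : Stage13HParams F N) (h' : θ'.Provisos₁₃SepCoPH F N), (θ'.ZhUnity F N ∧ θ'.SlotsNondegenerate₁₃ F N) ∧ θ'.Admissible F N ∧
      B16.EndStatementBPrinted (datumOfRecord₁₃SepCoPH F N θ' h').C ∧
      ∃ γ₁ : ℝ, 0 < γ₁ ∧ ∀ γ : ℝ, 0 < γ → γ ≤ γ₁ → ∃ P : B12.RunParams, 1 ≤ P.K ∧ ((datumOfRecord₁₃SepCoPH F N θ' h').C P).flow.InInterval γ P.K :=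
  N24_stabilityBR13SepCoPH_thetaShape20_rebindX_withB8_fourPin_pointed θ hP hθ hU X' Mstar ops ζ lamW (fun P => (upOfRecord₅CSC F N ((θ.rebindX F N X').view₁₃CoPHB10YZW F N Mstar ops ζ lamW) C₇ P).b8) w hC hγ hL
    (fun P => by rw [hup P]; rfl) h05SC h06 h07 h08 h09 h09T h10 h11 h12 hR hUV hlo hhi

end Literature.MathematicalPhysics.QuantumFieldTheory.Balaban1983to89.Node00

end
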